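import Literature.NumberTheory.LFunctions.RHWave0
import Literature.NumberTheory.LFunctions.LiouvilleCertificate.Chunk0
import Literature.NumberTheory.LFunctions.LiouvilleCertificate.Chunk1
import Literature.NumberTheory.LFunctions.LiouvilleCertificate.Chunk2
import Literature.NumberTheory.LFunctions.LiouvilleCertificate.Chunk3
import Literature.NumberTheory.LFunctions.LiouvilleCertificate.Chunk4
import Literature.NumberTheory.LFunctions.LiouvilleCertificate.Chunk5
import Literature.NumberTheory.LFunctions.LiouvilleCertificate.Chunk6
import Literature.NumberTheory.LFunctions.LiouvilleCertificate.Final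
import Literature.NumberTheory.LFunctions.MertensCertificate.Chunk00
import Literature.NumberTheory.LFunctions.MertensCertificate.Chunk01
import Literature.NumberTheory.LFunctions.MertensCertificate.Chunk02
import Literature.NumberTheory.LFunctions.MertensCertificate.Chunk03
import Literature.NumberTheory.LFunctions.MertensCertificate.Chunk04
import Literature.NumberTheory.LFunctions.MertensCertificate.Chunk05
import Literature.NumberTheory.LFunctions.MertensCertificate.Chunk06
import Literature.NumberTheory.LFunctions.MertensCertificate.Chunk07
import Literature.NumberTheory.LFunctions.MertensCertificate.Chunk08
import Literature.NumberTheory.LFunctions.MertensCertificate.Chunk09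
import Literature.NumberTheory.LFunctions.MertensCertificate.Chunk10
import Literature.NumberTheory.LFunctions.MertensCertificate.Chunk11
import Literature.NumberTheory.LFunctions.MertensCertificate.Chunk12
import Literature.NumberTheory.LFunctions.MertensCertificate.Chunk13
import Literature.NumberTheory.LFunctions.MertensCertificate.Chunk14
import Literature.NumberTheory.LFunctions.MertensCertificate.Chunk15
import Literature.NumberTheory.LFunctions.MertensCertificate.Chunk16
import Literature.NumberTheory.LFunctions.MertensCertificate.Chunk17
import Literature.NumberTheory.LFunctions.MertensCertificate.Chunk18
import Literature.NumberTheory.LFunctions.MertensCertificate.Chunk19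
import Literature.NumberTheory.LFunctions.MertensCertificate.Top
import HarnessLib

/-!
# RH family, wave 0 — proofs: Turán's conjecture is false (rh.S23), discharged

Topic: `Literature/NumberTheory/LFunctions`. Sibling proof file of `RHWave0.lean` for its `rh.S23`
named fact `Literature.NumberTheory.LFunctions.not_turan_conjecture` ("Turán's conjecture
`∑_{n ≤ x} λ(n)/n ≥ 0` for `x ≥ 1` is false"; `T(x) = ∑_{n ≤ x} λ(n)/n` is the tree's
`liouvilleHarmonicSum`).

Haselgrove 1958 disproved the conjecture by Ingham's method (Borwein–Ferguson–Mossinghoff 2008,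
§1 p. 1684: "Haselgrove found that selecting `m = 1000` and `y = 853.853` or `y = 996.980`
produces a negative value of `B*_m(y)`. It follows that `T(n) < 0` for infinitely many integers
`n`"; Titchmarsh §14.38: "Haselgrove [2] proved that (14.38.1) is false in general"). In the tree
the analytic part of that argument is proved (`ZetaQuotientKernelTheorem.lean`,
`TuranOneSided.lean`, `LiouvilleKernelTheorem.lean`:
`frequently_liouvilleHarmonicSum_natCast_neg_of_turanKernelSum_neg`) and its numerical
hypotheses are the object of the certified computation `LiouvilleCertificate.lean`
(`ZetaNumerics.Liouville.numerics_of_checks`, evaluated in the block files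
`LiouvilleCertificate/Chunk0.lean` … `Chunk6.lean`, `Final.lean`, on top of the 2000 certified zero
brackets and the zero count `N(2516) = 2000` of the Odlyzko–te Riele certificate,
`MertensCertificate/Chunk00.lean` … `Chunk19.lean`, `Top.lean`). This file holds the last,
elementary step (free of any computation):

* `not_turan_conjecture_iff` — `not_turan_conjecture ↔ ∃ n : ℕ, 1 ≤ n ∧ T(n) < 0` (`T` is a step
  function);
* `not_turan_conjecture_of_exists_nat_neg`, `not_turan_conjecture_of_frequently_neg` — a negative
  value of `T` at a natural number (necessarily `≥ 1`, as `T(0) = 0`), in particular Haselgrove's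
  "`T(n) < 0` for infinitely many `n`", gives `not_turan_conjecture`.

and the discharge:

* `not_turan_conjecture_holds` — the soundness theorem `ZetaNumerics.Liouville.numerics_of_checks`
  applied to the 29 compiled block evaluations gives (i) every zero `β + iγ` of `ζ` with
  `0 < β < 1`, `|γ| < 2516` is simple with `β = ½` and (ii) `Re B*(996.98037) < 0` for the
  Jurkat–Peyerimhoff weight `g(·/1000)` (BFM (7); Haselgrove's `m = 1000`, 649 zeros, `y = 996.980`);
  the kernel theorem `frequently_liouvilleHarmonicSum_natCast_neg_of_turanKernelSum_neg` (Ingham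
  1942 / Haselgrove 1958, `LiouvilleKernelTheorem.lean`) turns this into "`T(n) < 0` for infinitely
  many integers `n`", whence `not_turan_conjecture` by `not_turan_conjecture_of_frequently_neg`. The
  same chain, with the named intermediate statements (`T(n) < 0` and `L(n) > 0` infinitely often,
  `Literature.Barriers.RiemannHypothesis.Haselgrove1958_signChanges`), is left to the certificate's
  own assembly file (announced as `HaselgroveNumericsProofs.lean`); here it is inlined, so that this
  discharge depends on the block files only.

(A discharge through an explicit `n` — the least one is `72 185 376 951 205`, BFM Theorem 1, vendored
as `Literature.Barriers.RiemannHypothesis.BFM2008_thm1` — would need `λ(k)` for all `k ≤ 7.2·10¹³`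
or an `O(N^{2/3})`-step certified evaluation, out of reach of a single gate elaboration; Haselgrove's
method produces no explicit `n`.)

## Axioms

`not_turan_conjecture_holds` depends on `propext`, `Classical.choice`, `Quot.sound` and on the 29
`native_decide` auxiliary axioms of `MertensCertificate.ZetaNumerics.Mertens.checkChunk_00` …
`checkChunk_19`, `checkTop_holds` and `LiouvilleCertificate.ZetaNumerics.Liouville.checkChunk_0` …
`checkChunk_6`, `checkFinal_holds` (trust in the Lean compiler, the `Lean.ofReduceBool` /
`Lean.trustCompiler` family; proposal flag `computational`) — as the printed proof is a machine
computation with the first 649 zeros of `ζ` (BFM p. 1683). Everything else in the chain is proved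
from the standard axioms.

## References

* [BorweinFergusonMossinghoff2008] P. Borwein, R. Ferguson, M. J. Mossinghoff, *Sign changes in sums
  of the Liouville function*, Math. Comp. 77 (2008), 1681–1694 — §1 pp. 1683–1684, Thm. 1 p. 1685
  (read).
* [Titchmarsh1986] E. C. Titchmarsh, *The Theory of the Riemann Zeta-Function*, 2nd ed., §14.38
  (read).
* [HaselgroveMathematika1958] C. B. Haselgrove, *A disproof of a conjecture of Pólya*, Mathematika 5
  (1958), 141–145 (cited through the two items above).
-/

noncomputable section

open Filter

namespace Literature.NumberTheory.LFunctions

/-- `T(0) = 0` (empty sum). [folklore] -/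
theorem liouvilleHarmonicSum_natCast_zero : liouvilleHarmonicSum ((0 : ℕ) : ℝ) = 0 := by
  simp [liouvilleHarmonicSum]

/-- The tree's real-variable statement `not_turan_conjecture` (`¬ ∀ x ≥ 1, T(x) ≥ 0`) is equivalent
to the existence of an integer `n ≥ 1` with `T(n) < 0` (`T` is a step function, `T(x) = T(⌊x⌋₊)`).
[folklore] -/
theorem not_turan_conjecture_iff :
    not_turan_conjecture ↔ ∃ n : ℕ, 1 ≤ n ∧ liouvilleHarmonicSum n < 0 := by
  unfold not_turan_conjecture
  constructor
  · intro h
    by_contra hne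
    push Not at hne
    refine h fun x hx ↦ ?_
    -- `T(x) = T(⌊x⌋₊)` (cf. `Literature.Barriers.RiemannHypothesis.liouvilleHarmonicSum_eq_floor`)
    have hstep : liouvilleHarmonicSum x = liouvilleHarmonicSum (⌊x⌋₊ : ℕ) := by
      simp [liouvilleHarmonicSum, Nat.floor_natCast]
    rw [hstep]
    exact hne _ (Nat.le_floor (by exact_mod_cast hx))
  · rintro ⟨n, hn, hneg⟩ hT
    exact absurd (hT n (by exact_mod_cast hn)) (not_le.2 hneg)

/-- A negative value of Turán's sum `T` at a natural number `n` (necessarily `n ≥ 1`, as `T(0) = 0`)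
denies `∀ x ≥ 1, T(x) ≥ 0`, i.e. proves the tree's `not_turan_conjecture` (rh.S23). [folklore] -/
theorem not_turan_conjecture_of_exists_nat_neg (h : ∃ n : ℕ, liouvilleHarmonicSum n < 0) :
    not_turan_conjecture := by
  obtain ⟨n, hn⟩ := h
  refine not_turan_conjecture_iff.2 ⟨n, ?_, hn⟩
  rcases Nat.eq_zero_or_pos n with rfl | hpos
  · rw [liouvilleHarmonicSum_natCast_zero] at hn
    exact absurd hn (lt_irrefl 0)
  · exact hpos

/-- Haselgrove's theorem in the form "`T(n) < 0` for infinitely many integers `n`" (BFM 2008 §1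
p. 1684) gives `not_turan_conjecture`. [cite: BorweinFergusonMossinghoff2008, §1 p. 1684] -/
theorem not_turan_conjecture_of_frequently_neg
    (h : ∃ᶠ n : ℕ in atTop, liouvilleHarmonicSum n < 0) : not_turan_conjecture :=
  not_turan_conjecture_of_exists_nat_neg h.exists


/-! ## The discharge -/

open MertensCertificate.ZetaNumerics.Mertens LiouvilleCertificate.ZetaNumerics.Liouville ZetaNumerics in
/-- **rh.S23, discharged: Turán's conjecture `∑_{n ≤ x} λ(n)/n ≥ 0` (`x ≥ 1`) is false** — Haselgrove
1958 ("selecting `m = 1000` and … `y = 996.980` produces a negative value of `B*_m(y)`. It follows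
that `T(n) < 0` for infinitely many integers `n`", BFM 2008 §1 p. 1684; "Haselgrove [2] proved that
(14.38.1) is false in general", Titchmarsh §14.38). Proof: the certified numerics
(`ZetaNumerics.Liouville.numerics_of_checks` on the 29 compiled block checks: zeros below `2516`
simple and on the line, `Re B*(996.98037) < 0` for the Jurkat–Peyerimhoff weight at height `1000`),
the kernel theorem `frequently_liouvilleHarmonicSum_natCast_neg_of_turanKernelSum_neg`, and
`not_turan_conjecture_of_frequently_neg`. Uses the `native_decide` auxiliary axioms of the block
files (see the module docstring). [cite: HaselgroveMathematika1958, main theorem (Turán part), via BFM 2008 §1 p. 1684]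
[cite: BorweinFergusonMossinghoff2008, §1 (7) p. 1684] [cite: Titchmarsh1986, §14.38] -/
theorem not_turan_conjecture_holds : not_turan_conjecture := by
  -- the 20 + 1 Mertens block checks (zero brackets, twisted sign tests, count `N(2516) = 2000`)
  have hM : ∀ k < Mertens.NCHUNK, Mertens.checkChunk k = true := by
    intro k hk
    have hk20 : k < 20 := hk
    interval_cases k
    · exact checkChunk_00
    · exact checkChunk_01
    · exact checkChunk_02
    · exact checkChunk_03
    · exact checkChunk_04
    · exact checkChunk_05
    · exact checkChunk_06
    · exact checkChunk_07
    · exact checkChunk_08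
    · exact checkChunk_09
    · exact checkChunk_10
    · exact checkChunk_11
    · exact checkChunk_12
    · exact checkChunk_13
    · exact checkChunk_14
    · exact checkChunk_15
    · exact checkChunk_16
    · exact checkChunk_17
    · exact checkChunk_18
    · exact checkChunk_19
  -- the 7 + 1 Liouville block checks (summands of `A*`, `B*` over the 649 zeros below `1000`)
  have hCh : ∀ k < Liouville.NCHUNKL, Liouville.checkChunk k = true := by
    intro k hk
    have hk7 : k < 7 := hk
    interval_cases k
    · exact checkChunk_0
    · exact checkChunk_1
    · exact checkChunk_2
    · exact checkChunk_3
    · exact checkChunk_4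
    · exact checkChunk_5
    · exact checkChunk_6
  obtain ⟨hz, -, hneg⟩ := Liouville.numerics_of_checks hM
    MertensCertificate.ZetaNumerics.Mertens.checkTop_holds hCh
    LiouvilleCertificate.ZetaNumerics.Liouville.checkFinal_holds
  have hT₁ : (0 : ℝ) < Liouville.heightT1 := by rw [Liouville.heightT1_real]; norm_num
  have hT₁T : (Liouville.heightT1 : ℝ) ≤ Mertens.heightT0 := by
    rw [Liouville.heightT1_real, Mertens.heightT0_real]; norm_num
  exact not_turan_conjecture_of_frequently_neg
    (frequently_liouvilleHarmonicSum_natCast_neg_of_turanKernelSum_neg hT₁ hT₁T hz hneg)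

end Literature.NumberTheory.LFunctions
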